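import Summits.Parity.GeneralizedHardyLittlewood.Theorems.GreenTaoLevelTwoMNTwoTypeIMajorArc
import Summits.Parity.GeneralizedHardyLittlewood.Theorems.GreenTaoLevelTwoMNTwoDichotomy
import Summits.Parity.GeneralizedHardyLittlewood.Theorems.GreenTaoLevelTwoMNTwoScaleOfProgression
import Summits.Parity.GeneralizedHardyLittlewood.Theorems.GreenTaoLevelTwoMNTwoBohrGauge

/-!
# Route `GreenTaoLevelTwo`, crux `MNTwo` (stmt-Parity-21276), line `birth`, stub `stub_mnVertical`:
# Proposition 22 at one scale in the type I case (GT 2008b §10, end of the type I case)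

Block H4 / R4-I of the `stub_mnVertical` census (B. Green, T. Tao, *Quadratic uniformity of the
Möbius function*, Ann. Inst. Fourier 58 (2008) = arXiv:math/0606087, §10: "(Type I sum is large)
… Now simply let `𝒟` be the set of such `d`, set `L := X/ε` … and Proposition 22 follows").
Def-free composition, for the rotation Bohr gauge `ν(n) = maxᵢ‖nαᵢ‖ + |n|/N` of
`…MNTwoBohrGauge`, of the type I alternative of `…MNTwoDichotomy.dichotomy` (in its `ℕ`-indexed
output form, for the summand `F(n) = ψ(n)e(φ(n))`), Lemma 23 (`…MNTwoTypeIMajorArc.typeI_major_arc`)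
and the passage to one scale (`…MNTwoScaleOfProgression.good_at_scale_of_progression`): the
conclusion is the Prop-22 data at the scale `ρ₁` with budget `P` — exactly the shape of the
hypothesis `hP22` of `…MNTwoMajorArcOfPropTwentyTwo.majorArc_of_prop22` (and of "Prop. 22 at the
budget scale" in `…MNTwoInverseOfPropTwentyTwo`) — with `D = 2^{j+1}` and `𝒟` the set of good
`d ∼ 2^j`.  All polylogarithmic side conditions are kept as explicit hypotheses (`hQP`, `hQεP`,
`hsize`, `hdens`) to be discharged by the §10 assembly.

* `prop22_of_typeI` — the statement just described.

References: [GreenTao2008QuadraticMobius] arXiv:math/0606087 §10 (type I case), Lemma 23.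
-/

noncomputable section

open Finset Real

namespace Summit.Parity.GeneralizedHardyLittlewood.GreenTaoLevelTwoMNTwoTypeIBranch

open Summit.Parity.GeneralizedHardyLittlewood.GreenTaoLevelTwoMNTwoTypeIMajorArc (typeI_major_arc)
open Summit.Parity.GeneralizedHardyLittlewood.GreenTaoLevelTwoMNTwoDichotomy
  (sum_typeI_nat_eq_int vanish_off_Icc length_Icc_le)
open Summit.Parity.GeneralizedHardyLittlewood.GreenTaoLevelTwoMNTwoScaleOfProgression
  (good_at_scale_of_progression)
open Summit.Parity.GeneralizedHardyLittlewood.GreenTaoLevelTwoMNTwoBohrGauge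
  (bohrGauge_nonneg bohrGauge_zero bohrGauge_add_le bohrGauge_lt_iff abs_le_mul_bohrGauge
  iSup_norm_nonneg)

/-- **Proposition 22 at one scale, type I case (GT 2008b §10).**  There are absolute `A ∈ ℕ`,
`C ≥ 1` (those of Lemma 23) such that the following holds.  Let `ν(n) = maxᵢ‖nαᵢ‖ + |n|/N` be the
rotation gauge (`N ≥ 1`), `φ : ℤ → ℝ/ℤ` locally quadratic on `B(n₀,R)`, `ψ : ℤ → [0,1]`
`ν`-Lipschitz, supported in `B(n₀,ρ) ∩ (N,2N]`, `0 < ε`, `ρ + 5ε ≤ R`, `0 < η₁`, `2η₁ ≤ 1`,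
`16ε ≤ 2η₁`.  Suppose (the type I alternative of `…MNTwoDichotomy.dichotomy` for
`F = ψ·e(φ)`) that for some `j` and `U ≤ N` at least `η₁²2^j` integers `d ∈ [1,U]` with
`⌊log₂ d⌋ = j` have `η₁(2N)/2^j ≤ ‖∑_{1 ≤ w ≤ 2N/d} ψ(dw)e(φ(dw))‖`.  Let `0 < ρ₁ ≤ ε` and `P` satisfy
the budget conditions `Q₁ ≤ P`, `8Q₁ ≤ Pε²` (`Q₁ = C(512/(2η₁)²)^A`), the size condition
`4·32·38ᵏ·2^{j+1} ≤ (ρ₁/16)^{k+1}N/2` and the density condition `ρ₁(2^{j+1})²/P ≤ (η₁²2^j)²`.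
Then the conclusion of Proposition 22 holds at scale `ρ₁` with budget `P`: with `D = 2^{j+1}` and
`𝒟` the set of good `d`, `𝒟 ⊆ [1,D]`, `ρ₁D²/P ≤ #𝒟²`, and every multiple `n ∈ B(ρ₁)` of every
`d ∈ 𝒟` has `1 ≤ q ≤ P` with `‖q•φ''(n,n)‖ ≤ Pρ₁²`.
[cite: GreenTao2008QuadraticMobius, §10 (type I case, "let `𝒟` be the set of such `d`"), Lemma 23] -/
theorem prop22_of_typeI (k : ℕ) :
    ∃ (A : ℕ) (C : ℝ), 1 ≤ C ∧
      ∀ (N : ℕ), 1 ≤ N → ∀ (α : Fin k → ℝ) (n₀ : ℤ) (R ρ ε : ℝ) (φ : ℤ → UnitAddCircle),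
        (∀ n a b c : ℤ,
          (⨆ i : Fin k, ‖((((n - n₀ : ℤ) : ℝ) * α i : ℝ) : AddCircle (1 : ℝ))‖) +
              |((n - n₀ : ℤ) : ℝ)| / N < R →
          (⨆ i : Fin k, ‖((((n + a - n₀ : ℤ) : ℝ) * α i : ℝ) : AddCircle (1 : ℝ))‖) +
              |((n + a - n₀ : ℤ) : ℝ)| / N < R →
          (⨆ i : Fin k, ‖((((n + b - n₀ : ℤ) : ℝ) * α i : ℝ) : AddCircle (1 : ℝ))‖) +
              |((n + b - n₀ : ℤ) : ℝ)| / N < R →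
          (⨆ i : Fin k, ‖((((n + c - n₀ : ℤ) : ℝ) * α i : ℝ) : AddCircle (1 : ℝ))‖) +
              |((n + c - n₀ : ℤ) : ℝ)| / N < R →
          (⨆ i : Fin k, ‖((((n + a + b - n₀ : ℤ) : ℝ) * α i : ℝ) : AddCircle (1 : ℝ))‖) +
              |((n + a + b - n₀ : ℤ) : ℝ)| / N < R →
          (⨆ i : Fin k, ‖((((n + a + c - n₀ : ℤ) : ℝ) * α i : ℝ) : AddCircle (1 : ℝ))‖) +
              |((n + a + c - n₀ : ℤ) : ℝ)| / N < R →
          (⨆ i : Fin k, ‖((((n + b + c - n₀ : ℤ) : ℝ) * α i : ℝ) : AddCircle (1 : ℝ))‖) +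
              |((n + b + c - n₀ : ℤ) : ℝ)| / N < R →
          (⨆ i : Fin k, ‖((((n + a + b + c - n₀ : ℤ) : ℝ) * α i : ℝ) : AddCircle (1 : ℝ))‖) +
              |((n + a + b + c - n₀ : ℤ) : ℝ)| / N < R →
          φ (n + a + b + c) - φ (n + a + b) - φ (n + a + c) - φ (n + b + c)
            + φ (n + a) + φ (n + b) + φ (n + c) - φ n = 0) →
        0 < ε → ρ + 5 * ε ≤ R →
      ∀ (ψ : ℤ → ℝ), (∀ n, 0 ≤ ψ n) → (∀ n, ψ n ≤ 1) →
        (∀ n, ψ n ≠ 0 →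
          (⨆ i : Fin k, ‖((((n - n₀ : ℤ) : ℝ) * α i : ℝ) : AddCircle (1 : ℝ))‖) +
            |((n - n₀ : ℤ) : ℝ)| / N < ρ) →
        (∀ n, ψ n ≠ 0 → (N : ℤ) < n ∧ n ≤ 2 * N) →
        (∀ n n' : ℤ, |ψ n - ψ n'| ≤
          (⨆ i : Fin k, ‖((((n - n' : ℤ) : ℝ) * α i : ℝ) : AddCircle (1 : ℝ))‖) +
            |((n - n' : ℤ) : ℝ)| / N) →
      ∀ (η₁ : ℝ), 0 < η₁ → 2 * η₁ ≤ 1 → 16 * ε ≤ 2 * η₁ →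
      ∀ (U j : ℕ), U ≤ N →
        η₁ ^ 2 * 2 ^ j ≤ #((Icc 1 U).filter fun d => Nat.log 2 d = j ∧
          η₁ * ((2 * N : ℕ) : ℝ) / 2 ^ j ≤
            ‖∑ w ∈ Icc 1 (2 * N / d), ((ψ ((d * w : ℕ) : ℤ) : ℝ) : ℂ) *
              (AddCircle.toCircle (φ ((d * w : ℕ) : ℤ)) : ℂ)‖) →
      ∀ (P ρ₁ : ℝ), 0 < ρ₁ → ρ₁ ≤ ε →
        C * (512 * 1 ^ 2 / (2 * η₁) ^ 2) ^ A ≤ P →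
        8 * (C * (512 * 1 ^ 2 / (2 * η₁) ^ 2) ^ A) ≤ P * ε ^ 2 →
        4 * (32 * 38 ^ k) * ((2 ^ (j + 1) : ℕ) : ℝ) ≤ (ρ₁ / 16) ^ (k + 1) * N / 2 →
        ρ₁ * ((2 ^ (j + 1) : ℕ) : ℝ) ^ 2 / P ≤ (η₁ ^ 2 * 2 ^ j) ^ 2 →
        ∃ (D : ℕ) (𝒟 : Finset ℕ), 1 ≤ D ∧ 𝒟 ⊆ Icc 1 D ∧
          4 * (32 * 38 ^ k) * (D : ℝ) ≤ (ρ₁ / 16) ^ (k + 1) * N / 2 ∧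
          ρ₁ * (D : ℝ) ^ 2 / P ≤ (#𝒟 : ℝ) ^ 2 ∧
          ∀ d ∈ 𝒟, ∀ n ∈ (Finset.Ioo (-(N : ℤ)) N).filter fun n : ℤ =>
              (∀ i, ‖(((n : ℝ) * α i : ℝ) : AddCircle (1 : ℝ))‖ + |(n : ℝ)| / N < ρ₁) ∧
                |(n : ℝ)| / N < ρ₁,
            (d : ℤ) ∣ n → ∃ q : ℕ, 1 ≤ q ∧ (q : ℝ) ≤ P ∧
              ‖((q : ℤ)) • (φ (n₀ + n + n) - φ (n₀ + n) - φ (n₀ + n) + φ n₀)‖ ≤ P * ρ₁ ^ 2 := by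
  classical
  obtain ⟨A, C, hC1, hI⟩ := typeI_major_arc
  refine ⟨A, C, hC1, ?_⟩
  intro N hN α n₀ R ρ ε φ hφ hε hR ψ hψ0 hψ1 hsupp hsuppN hlip η₁ hη₁ hη₁1 hεη U j hUN hgood
    P ρ₁ hρ₁ hρ₁ε hQP hQεP hsize hdens
  -- the gauge
  set ν : ℤ → ℝ := fun n => (⨆ i : Fin k, ‖(((n : ℝ) * α i : ℝ) : AddCircle (1 : ℝ))‖) +
    |(n : ℝ)| / N with hν
  have hν0 : ν 0 = 0 := bohrGauge_zero α N
  have hνnn : ∀ x, 0 ≤ ν x := fun x => bohrGauge_nonneg α N x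
  have hνadd : ∀ x y, ν (x + y) ≤ ν x + ν y := fun x y => bohrGauge_add_le α N x y
  have hνN : ∀ n : ℤ, |(n : ℝ)| ≤ N * ν n := fun n => abs_le_mul_bohrGauge α hN n
  -- the set of good divisors and the type I budget
  set 𝒟 : Finset ℕ := (Icc 1 U).filter fun d => Nat.log 2 d = j ∧
      η₁ * ((2 * N : ℕ) : ℝ) / 2 ^ j ≤
        ‖∑ w ∈ Icc 1 (2 * N / d), ((ψ ((d * w : ℕ) : ℤ) : ℝ) : ℂ) *
          (AddCircle.toCircle (φ ((d * w : ℕ) : ℤ)) : ℂ)‖ with h𝒟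
  set Q₁ : ℝ := C * (512 * 1 ^ 2 / (2 * η₁) ^ 2) ^ A with hQ₁
  have hQ₁0 : 0 ≤ Q₁ := by rw [hQ₁]; positivity
  have hNr : (0 : ℝ) < N := by exact_mod_cast hN
  refine ⟨2 ^ (j + 1), 𝒟, Nat.one_le_two_pow, ?_, hsize, ?_, ?_⟩
  · -- `𝒟 ⊆ [1, 2^{j+1}]`
    intro d hd
    rw [h𝒟, mem_filter, mem_Icc] at hd
    rw [mem_Icc]
    refine ⟨hd.1.1, ?_⟩
    have := Nat.lt_pow_succ_log_self (b := 2) (by norm_num) d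
    rw [hd.2.1] at this
    exact this.le
  · -- density `ρ₁D²/P ≤ (η₁²2^j)² ≤ #𝒟²`
    exact hdens.trans (pow_le_pow_left₀ (by positivity) hgood 2)
  · -- the main clause: every multiple `n ∈ B(ρ₁)` of a good `d`
    intro d hd n hn hdn
    rw [h𝒟, mem_filter, mem_Icc] at hd
    obtain ⟨⟨hd1, hdU⟩, hlog, hlargeℕ⟩ := hd
    have hdN : d ≤ N := hdU.trans hUN
    have hd0 : d ≠ 0 := by omega
    have hdz : (d : ℤ) ≠ 0 := by exact_mod_cast hd0
    have hνn : ν n < ρ₁ := by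
      rw [mem_filter] at hn
      exact (bohrGauge_lt_iff α N n ρ₁).2 hn.2
    -- the summand along `ℤ` and its support
    set f : ℤ → ℂ := fun m => ((ψ m : ℝ) : ℂ) * (AddCircle.toCircle (φ m) : ℂ) with hf
    have hψ0' : ∀ m : ℤ, ¬ ((N : ℤ) < m ∧ m ≤ 2 * N) → ψ m = 0 := by
      intro m hm
      by_contra h
      exact hm (hsuppN m h)
    have hfN : ∀ m : ℤ, m ≤ N → f m = 0 := by
      intro m hm
      have : ψ m = 0 := hψ0' m (by omega)
      simp only [hf, this, Complex.ofReal_zero, zero_mul]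
    have hψC : ∀ m : ℤ, ¬ ((N : ℤ) < m ∧ m ≤ 2 * N) → (fun m => ((ψ m : ℝ) : ℂ)) m = 0 := by
      intro m hm
      simp only [hψ0' m hm, Complex.ofReal_zero]
    have hsuppw : ∀ w : ℤ, w ∉ Icc (0 : ℤ) ((2 * N / d : ℕ) : ℤ) → ψ ((d : ℤ) * w) = 0 := by
      intro w hw
      have h := vanish_off_Icc (N := N) (fun m => ((ψ m : ℝ) : ℂ)) hψC hd1 w hw
      exact_mod_cast h
    have hlen := length_Icc_le (N := N) hd1 hdN
    -- the large type I sum in `ℤ`-indexed form, with `δ = 2η₁`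
    have hlargeZ : 2 * η₁ * N / |((d : ℤ) : ℝ)| ≤
        ‖∑ w ∈ Icc (0 : ℤ) ((2 * N / d : ℕ) : ℤ), ((ψ ((d : ℤ) * w) : ℝ) : ℂ) *
          (AddCircle.toCircle (φ ((d : ℤ) * w)) : ℂ)‖ := by
      have e : ∑ w ∈ Icc 1 (2 * N / d), ((ψ ((d * w : ℕ) : ℤ) : ℝ) : ℂ) *
            (AddCircle.toCircle (φ ((d * w : ℕ) : ℤ)) : ℂ) =
          ∑ w ∈ Icc (0 : ℤ) ((2 * N / d : ℕ) : ℤ), ((ψ ((d : ℤ) * w) : ℝ) : ℂ) *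
            (AddCircle.toCircle (φ ((d : ℤ) * w)) : ℂ) :=
        sum_typeI_nat_eq_int f hfN d (2 * N / d)
      rw [← e]
      have h2j : ((2 : ℕ) ^ j : ℕ) ≤ d := by
        have := Nat.pow_log_le_self 2 hd0
        rwa [hlog] at this
      have h2jr : (2 : ℝ) ^ j ≤ (d : ℝ) := by exact_mod_cast h2j
      have habs : |((d : ℤ) : ℝ)| = (d : ℝ) := by
        rw [Int.cast_natCast, Nat.abs_cast]
      rw [habs]
      calc 2 * η₁ * N / (d : ℝ) = η₁ * ((2 * N : ℕ) : ℝ) / (d : ℝ) := by push_cast; ring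
        _ ≤ η₁ * ((2 * N : ℕ) : ℝ) / 2 ^ j :=
            div_le_div_of_nonneg_left (by positivity) (by positivity) h2jr
        _ ≤ _ := hlargeℕ
    -- Lemma 23 along the progressions `{d t}`
    have hprog : ∀ (L : ℕ), 1 ≤ L → ∀ (t : ℤ), (L : ℝ) * ν ((d : ℤ) * t) ≤ ε →
        ∃ q : ℕ, 1 ≤ q ∧ (q : ℝ) ≤ Q₁ ∧
          ‖q • (φ (n₀ + d * t + d * t) - φ (n₀ + d * t) - φ (n₀ + d * t) + φ n₀)‖ ≤
            (2 * Q₁) / (L : ℝ) ^ 2 := by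
      intro L hL t hLt
      obtain ⟨q, hq1, hqQ, hqb⟩ := hI ν hν0 hνnn hνadd N hN hνN φ n₀ R ρ ε hφ hε hR ψ 1 le_rfl
        hψ0 hψ1 hsupp hlip (2 * η₁) (by positivity) hη₁1 (by linarith) (d : ℤ) hdz 0
        ((2 * N / d : ℕ) : ℤ) (by positivity) hsuppw hlen hlargeZ L hL t hLt
      exact ⟨q, hq1, hqQ, hqb.trans (le_of_eq (by ring))⟩
    -- one scale
    obtain ⟨q, hq1, hqQ, hqb⟩ := good_at_scale_of_progression ν hνnn φ n₀ (d : ℤ) (Q := Q₁)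
      (ε := ε) (M := 2 * Q₁) (ρ₁ := ρ₁) (by positivity) hρ₁ hρ₁ε hprog n hνn hdn
    refine ⟨q, hq1, hqQ.trans hQP, hqb.trans ?_⟩
    have h8 : 8 * Q₁ / ε ^ 2 ≤ P := by rw [div_le_iff₀ (by positivity)]; exact hQεP
    calc 4 * (2 * Q₁) * ρ₁ ^ 2 / ε ^ 2 = (8 * Q₁ / ε ^ 2) * ρ₁ ^ 2 := by ring
      _ ≤ P * ρ₁ ^ 2 := mul_le_mul_of_nonneg_right h8 (by positivity)

end Summit.Parity.GeneralizedHardyLittlewood.GreenTaoLevelTwoMNTwoTypeIBranch
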